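import Literature.AlgebraicGeometry.Shioda1982.ExceptionalQuadruplesComplete
import HarnessLib

/-!
# Shioda 1982 / Meyer–Neutsch 1981: no exceptional quadruple at the levels `150 ≤ N ≤ 153` absent from Tabelle 1 (kernel sweep)

Topic `Literature/AlgebraicGeometry/Shioda1982`; companion of `ExceptionalQuadruplesComplete.lean` (search `checkB`, soundness
`tabelleOneCompleteAt_of_chunks`, invariant form `exists_mem_reps_of_isExceptionalQuadruple`, statement `TabelleOneCompleteAt`; sources,
method and framing in its module docstring), of the sweeps `ExceptionalQuadruplesSweepSixty/…/Ninety.lean` (all `2 ≤ N ≤ 90`),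
`…SweepOneHundredTwelve.lean` (`N = 112`), `…SweepOneHundredThirtyTwo.lean` (`N = 132`) and of the other files of this series
(`ExceptionalQuadruplesSweep<lo>To<hi>.lean`, together: every level `91 ≤ N ≤ 179` that is not a row of Tabelle 1). THEOREMS only (no
definition, no named fact): the kernel search at each level `N` of this file's range that carries NO row of
[MeyerNeutsch1981Fermatquadrupel, Tabelle 1] (computer-generated there, "alle Fermatquadrupel für N ≤ 614 ermittelt", §2 p. 53; zeros of
[Shioda1982PicardFermat, table p. 727], whose non-zero entries `N ≤ 180` are exactly the 22 table levels): `completeAt_<N>` (every sorted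
pair-free primitive Hodge 4-multiset mod `N` is standard) and `not_isExceptionalQuadruple_<N>`. With the table levels
(`ExceptionalQuadruplesComplete*.lean`: the printed list is complete at each of its 22 levels `≤ 180`) the series makes Meyer–Neutsch's
classification of the exceptional surface classes kernel-certified at EVERY level `N ≤ 180`; above `180` there are none by Aoki's
Theorem C ([Aoki1983], computer-assisted for `181 ≤ m ≤ 672`, not a kernel statement). `decide +kernel` only (no `native_decide`),
chunked by first entries to bound the memory of a single kernel evaluation (≈ 0.9 ms of kernel time per candidate triple; this file
visits 397953 candidates).

HONEST FRAMING (cell `pub-hfermat`): explicit algebraic cycles for specific Hodge classes on Fermat/Delsarte varieties; residual open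
instances listed; no claim on general Hodge. These classes are algebraic (Lefschetz (1,1)); certified here is only the emptiness of the
exceptional list at these levels.

## References
* [MeyerNeutsch1981Fermatquadrupel] W. Meyer, W. Neutsch, *Fermatquadrupel*, Math. Ann. 256 (1981) 51–62, §2 p. 53, Tabelle 1 p. 54 (no rows 150, 151, 152, 153).
* [Shioda1982PicardFermat] T. Shioda, J. Fac. Sci. Univ. Tokyo IA 28 (1982) 725–734, table p. 727.
* [Aoki1983] N. Aoki, Math. Ann. 266 (1983) 23–54, Thm. C.
-/

namespace Literature.AlgebraicGeometry.Shioda1982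

open Literature.AlgebraicGeometry.HodgeTheory

set_option maxHeartbeats 0 in
/-- **Tabelle 1 is complete at `N = 150`, where it is empty**: every sorted Hodge 4-multiset mod `150` without a pair and with
`gcd = 1` is standard. Kernel exhaustion (`checkB`, 4 chunks of first entries, 96575 candidate triples).
[cite: MeyerNeutsch1981Fermatquadrupel, §2 p. 53 ("alle Fermatquadrupel für N ≤ 614 ermittelt") and Tabelle 1 p. 54 (no row 150)]
[cite: Shioda1982PicardFermat, table p. 727] -/
theorem completeAt_oneHundredFifty : TabelleOneCompleteAt 150 :=
  tabelleOneCompleteAt_of_chunks 150 [(0, 12), (12, 12), (24, 13), (37, 113)] (by decide +kernel) (by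
    intro p hp
    simp only [List.mem_cons, List.not_mem_nil, or_false] at hp
    rcases hp with rfl | rfl | rfl | rfl <;> decide +kernel)

set_option maxHeartbeats 0 in
/-- **Tabelle 1 is complete at `N = 151`, where it is empty**: every sorted Hodge 4-multiset mod `151` without a pair and with
`gcd = 1` is standard. Kernel exhaustion (`checkB`, 5 chunks of first entries, 98500 candidate triples).
[cite: MeyerNeutsch1981Fermatquadrupel, §2 p. 53 ("alle Fermatquadrupel für N ≤ 614 ermittelt") and Tabelle 1 p. 54 (no row 151)]
[cite: Shioda1982PicardFermat, table p. 727] -/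
theorem completeAt_oneHundredFiftyOne : TabelleOneCompleteAt 151 :=
  tabelleOneCompleteAt_of_chunks 151 [(0, 12), (12, 12), (24, 13), (37, 28), (65, 86)] (by decide +kernel) (by
    intro p hp
    simp only [List.mem_cons, List.not_mem_nil, or_false] at hp
    rcases hp with rfl | rfl | rfl | rfl | rfl <;> decide +kernel)

set_option maxHeartbeats 0 in
/-- **Tabelle 1 is complete at `N = 152`, where it is empty**: every sorted Hodge 4-multiset mod `152` without a pair and with
`gcd = 1` is standard. Kernel exhaustion (`checkB`, 5 chunks of first entries, 100451 candidate triples).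
[cite: MeyerNeutsch1981Fermatquadrupel, §2 p. 53 ("alle Fermatquadrupel für N ≤ 614 ermittelt") and Tabelle 1 p. 54 (no row 152)]
[cite: Shioda1982PicardFermat, table p. 727] -/
theorem completeAt_oneHundredFiftyTwo : TabelleOneCompleteAt 152 :=
  tabelleOneCompleteAt_of_chunks 152 [(0, 12), (12, 11), (23, 13), (36, 21), (57, 95)] (by decide +kernel) (by
    intro p hp
    simp only [List.mem_cons, List.not_mem_nil, or_false] at hp
    rcases hp with rfl | rfl | rfl | rfl | rfl <;> decide +kernel)

set_option maxHeartbeats 0 in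
/-- **Tabelle 1 is complete at `N = 153`, where it is empty**: every sorted Hodge 4-multiset mod `153` without a pair and with
`gcd = 1` is standard. Kernel exhaustion (`checkB`, 5 chunks of first entries, 102427 candidate triples).
[cite: MeyerNeutsch1981Fermatquadrupel, §2 p. 53 ("alle Fermatquadrupel für N ≤ 614 ermittelt") and Tabelle 1 p. 54 (no row 153)]
[cite: Shioda1982PicardFermat, table p. 727] -/
theorem completeAt_oneHundredFiftyThree : TabelleOneCompleteAt 153 :=
  tabelleOneCompleteAt_of_chunks 153 [(0, 12), (12, 11), (23, 12), (35, 19), (54, 99)] (by decide +kernel) (by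
    intro p hp
    simp only [List.mem_cons, List.not_mem_nil, or_false] at hp
    rcases hp with rfl | rfl | rfl | rfl | rfl <;> decide +kernel)

/-- **No exceptional quadruple ("Ausnahmequadrupel") at the level `150`** (`tabelleOne 150 = []`).
[cite: MeyerNeutsch1981Fermatquadrupel, Tabelle 1 p. 54 (no row 150)] [cite: Shioda1982PicardFermat, table p. 727] -/
theorem not_isExceptionalQuadruple_oneHundredFifty (s : Multiset (ZMod 150)) : ¬ IsExceptionalQuadruple 150 s := by
  intro hs
  obtain ⟨r, hr, -⟩ := exists_mem_reps_of_isExceptionalQuadruple completeAt_oneHundredFifty hs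
  simp [reps, tabelleOne] at hr

/-- **No exceptional quadruple ("Ausnahmequadrupel") at the level `151`** (`tabelleOne 151 = []`).
[cite: MeyerNeutsch1981Fermatquadrupel, Tabelle 1 p. 54 (no row 151)] [cite: Shioda1982PicardFermat, table p. 727] -/
theorem not_isExceptionalQuadruple_oneHundredFiftyOne (s : Multiset (ZMod 151)) : ¬ IsExceptionalQuadruple 151 s := by
  intro hs
  obtain ⟨r, hr, -⟩ := exists_mem_reps_of_isExceptionalQuadruple completeAt_oneHundredFiftyOne hs
  simp [reps, tabelleOne] at hr

/-- **No exceptional quadruple ("Ausnahmequadrupel") at the level `152`** (`tabelleOne 152 = []`).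
[cite: MeyerNeutsch1981Fermatquadrupel, Tabelle 1 p. 54 (no row 152)] [cite: Shioda1982PicardFermat, table p. 727] -/
theorem not_isExceptionalQuadruple_oneHundredFiftyTwo (s : Multiset (ZMod 152)) : ¬ IsExceptionalQuadruple 152 s := by
  intro hs
  obtain ⟨r, hr, -⟩ := exists_mem_reps_of_isExceptionalQuadruple completeAt_oneHundredFiftyTwo hs
  simp [reps, tabelleOne] at hr

/-- **No exceptional quadruple ("Ausnahmequadrupel") at the level `153`** (`tabelleOne 153 = []`).
[cite: MeyerNeutsch1981Fermatquadrupel, Tabelle 1 p. 54 (no row 153)] [cite: Shioda1982PicardFermat, table p. 727] -/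
theorem not_isExceptionalQuadruple_oneHundredFiftyThree (s : Multiset (ZMod 153)) : ¬ IsExceptionalQuadruple 153 s := by
  intro hs
  obtain ⟨r, hr, -⟩ := exists_mem_reps_of_isExceptionalQuadruple completeAt_oneHundredFiftyThree hs
  simp [reps, tabelleOne] at hr

end Literature.AlgebraicGeometry.Shioda1982
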